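import Summits.CriticalPhenomena.PercolationContinuityZ3.Theorems.PercNearOneGluingNoHeavyLowerTailAntitheticConeMixedShift
import Summits.CriticalPhenomena.PercolationContinuityZ3.Theorems.PercNearOneGluingNoHeavyLowerTailAntitheticTransportShift
import Summits.CriticalPhenomena.PercolationContinuityZ3.Theorems.PercNearOneGluingNoHeavyLowerTailAntitheticK25Sep
import HarnessLib

/-!
# `NoHeavyLowerTail` (stmt-CriticalPhenomena-4575) — antithetic cluster pairs: **THEOREM K25E — `K_{2,5}` FROM A POLE PLUS AN EAR from the
# other pole to a middle**: CONJECTURE Δ2 / the vertex antithetic inequality at `R = {x}` at the ear vertex next to the middle, all ear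
# lengths ≥ 3 — a core that FAILS ⊕ IN EVERY FORM (K-form ≤ −53, shifted −3; HOME/MEMO-gen67.md §4), handled because a `z`-arm of length 0
# needs only the mixed hypothesis (M)_shift, which `K_{2,5}` satisfies by a separable certificate (…AntitheticK25Sep) (prim-hp-2 gen 67,
# HOME/MEMO-gen67.md §2bis: THEOREM TE proves (M)_shift(K_{2,k}; c, m) ≥ 0 for ALL k on paper — this file is its Lean instance k = 5)

Support file (`--supports stmt-CriticalPhenomena-4575`, hull-port prover `prim-hp-2`, gen 67).  No definitions, no named facts, no sorries;
COMPUTATIONAL only through …AntitheticK25Sep.  `K_{2,5}`: poles `c 0 = s` and `c 1`, middles `c 2, …, c 6`; ear `c 1 = u 0 – u 1 – … – u a = y – x – c 2`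
(`a ≥ 1`; for `a = 0` the hypotheses `hg`/the edge `c 1 c 2` clash).  Proof = `Pendant.handle_vertex_sum_nonneg_of_shift`
(…HandlePrincipleShift) with `b = 0` — its (⊕_j) hypotheses are vacuous — and (M)_shift(K25; c 1, c 2) transported from the certificate.
* `Antithetic.K25.ear_vertex_sum_nonneg` — **THEOREM K25E**.
[cite: VandenbergHaggstromKahn2005, §1 p. 6 ("Harris' inequality"), §1 p. 3 (open cluster `C_s`)]
-/

noncomputable section

namespace Summit.CriticalPhenomena.PercolationContinuityZ3.Theorems

open Literature.Probability.Percolation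
open scoped Classical

namespace Antithetic

namespace K25

variable {V : Type*} [Fintype V] {c : Fin 7 → V} (hc : Function.Injective c) {E₀ : Set (Sym2 V)}
  (hE₀ : E₀ = Sym2.map c '' ↑({s(0, 2), s(1, 2), s(0, 3), s(1, 3), s(0, 4), s(1, 4), s(0, 5), s(1, 5), s(0, 6), s(1, 6)} : Finset (Sym2 (Fin 7))))
  {u : ℕ → V} {a : ℕ} (hu0 : u 0 = c 1)
  (hufresh : ∀ i, 0 < i → i ≤ a → ∀ f ∈ E₀, u i ∈ f → f.IsDiag)
  (huinj : ∀ i j, i ≤ a → j ≤ a → u i = u j → i = j) (hsu : ∀ i, 0 < i → i ≤ a → c 0 ≠ u i) (hQu : ∀ i, 0 < i → i ≤ a → c 2 ≠ u i)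
include hc hE₀ hu0 hufresh huinj hsu hQu

/-- **THEOREM K25E (`K_{2,5}` + ear from the pole to a middle, all lengths).**  `K_{2,5}` on the poles `c 0 = s`, `c 1` and the middles
`c 2, …, c 6` (`c` injective, image edge set `E₀`); an arm `c 1 = u 0, u 1, …, u a = y` of fresh vertices; `x` fresh, joined to `y` and to
the middle `c 2` (`y ≠ c 2`, `y c 2 ∉ E₀ ∪ arm`, so `a ≥ 1`).  Then for all monotone `F, G`:
`0 ≤ Σ_{ω : ¬(x ∈ X_E ω ∧ x ∈ Y_E ω)} (F(X_E ω) − F(Y_E ω))·(G(X_E ω) − G(Y_E ω))`, `E = (arm ∪ E₀) + xy + x c2`. [this work] -/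
theorem ear_vertex_sum_nonneg {x : V} (hx : ∀ f ∈ Cyc.edgeSet a u ∪ E₀, x ∈ f → f.IsDiag) (hxs : x ≠ c 0) (hxy : x ≠ u a)
    (hxQ : x ≠ c 2) (hyQ : u a ≠ c 2) (hg : s(u a, c 2) ∉ Cyc.edgeSet a u ∪ E₀)
    {F G : Set V → ℝ} (hF : Monotone F) (hG : Monotone G) :
    0 ≤ ∑ ω ∈ Finset.univ.filter (fun ω : Set (Sym2 V) =>
        ¬ ((openGraph (ω ∩ insert s(x, u a) (insert s(x, c 2) (Cyc.edgeSet a u ∪ E₀)))).Reachable (c 0) x ∧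
          (openGraph (ωᶜ ∩ insert s(x, u a) (insert s(x, c 2) (Cyc.edgeSet a u ∪ E₀)))).Reachable (c 0) x)),
      (F (openCluster (ω ∩ insert s(x, u a) (insert s(x, c 2) (Cyc.edgeSet a u ∪ E₀))) (c 0)) -
          F (openCluster (ωᶜ ∩ insert s(x, u a) (insert s(x, c 2) (Cyc.edgeSet a u ∪ E₀))) (c 0))) *
        (G (openCluster (ω ∩ insert s(x, u a) (insert s(x, c 2) (Cyc.edgeSet a u ∪ E₀))) (c 0)) -
          G (openCluster (ωᶜ ∩ insert s(x, u a) (insert s(x, c 2) (Cyc.edgeSet a u ∪ E₀))) (c 0))) := by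
  -- no loops
  have hK : ∀ e ∈ ({s(0, 2), s(1, 2), s(0, 3), s(1, 3), s(0, 4), s(1, 4), s(0, 5), s(1, 5), s(0, 6), s(1, 6)} : Finset (Sym2 (Fin 7))),
      ¬ e.IsDiag := by decide
  have hnd : ∀ f ∈ E₀, ¬ f.IsDiag := by
    intro f hf
    rw [hE₀] at hf
    obtain ⟨e, he, rfl⟩ := hf
    have hne := hK e (Finset.mem_coe.1 he)
    induction e using Sym2.ind with
    | h i j =>
      rw [Sym2.map_mk, Sym2.mk_isDiag_iff]
      rw [Sym2.mk_isDiag_iff] at hne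
      exact fun h => hne (hc h)
  -- (M)_shift of `(K25; c 1, c 2)` from the certificate, transported along `c`
  have hmix : ∀ Fp Fm Gp Gm : Set V → ℝ, Monotone Fp → Monotone Fm → (∀ S, Fm S ≤ Fp S) →
      Monotone Gp → Monotone Gm → (∀ S, Gm S ≤ Gp S) →
      0 ≤ ∑ T ∈ Finset.univ.filter (fun T : Set (Sym2 V) =>
          c 1 ∈ openCluster (T ∩ E₀) (c 0) ∧ c 2 ∉ openCluster (Tᶜ ∩ E₀) (c 0)),
        (Fp (openCluster (T ∩ E₀) (c 0)) - Fm (openCluster (Tᶜ ∩ E₀) (c 0))) *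
          (Gp (openCluster (T ∩ E₀) (c 0)) - Gm (openCluster (Tᶜ ∩ E₀) (c 0))) :=
    fun Fp Fm Gp Gm hFp hFm hF' hGp hGm hG' =>
      TransportShift.mixed_of_powerset hc _ 0 1 2
        (fun Lp Lm Mp Mm hLp hLm hL hMp hMm hM => by
          convert mixed_shift_mid_powerset Lp Lm Mp Mm hLp hLm hL hMp hMm hM using 10)
        hE₀ Fp Fm Gp Gm hFp hFm hF' hGp hGm hG'
  -- the `z`-arm of length `0`
  let w : ℕ → V := fun _ => c 2
  have hw0 : w 0 = c 2 := rfl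
  have hE : Cyc.edgeSet a u ∪ E₀ = (Cyc.edgeSet a u ∪ E₀) ∪ Cyc.edgeSet 0 w := by
    rw [TwoStage.Cone.edgeSet_zero, Set.union_empty]
  have hufresh' : ∀ i, 0 < i → i ≤ a → ∀ f ∈ E₀ ∪ Cyc.edgeSet 0 w, u i ∈ f → f.IsDiag := by
    intro i hi hia f hf huf
    rw [TwoStage.Cone.edgeSet_zero, Set.union_empty] at hf
    exact hufresh i hi hia f hf huf
  have h := Pendant.handle_vertex_sum_nonneg_of_shift (E₀ := E₀) (s := c 0) (P := c 1) (Q := c 2) (u := u) (w := w) (a := a) (b := 0)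
    hu0 hw0 hufresh' (fun i hi hib => absurd hib (by omega)) huinj (fun i j hi hj _ => by omega) hsu
    (fun i hi hib => absurd hib (by omega)) (fun i hi hib => absurd hib (by omega)) hQu
    (fun j hj => absurd hj (Nat.not_lt_zero j)) hmix hnd (x := x) (by rw [← hE]; exact hx) hxs hxy hxQ hyQ (by rw [← hE]; exact hg) hF hG
  rw [← hE, hw0] at h
  convert h using 3

end K25

end Antithetic

end Summit.CriticalPhenomena.PercolationContinuityZ3.Theorems
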